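import Summits.QuantumFields.YangMills.Theorems.DirichletWindowAllSidesChessboardTwistedOddCore
import HarnessLib

/-!
# The TWISTED two-class chessboard estimate on a block torus of odd side — the walk and the estimate

Support file for item stmt-QuantumFields-20194 (`DirichletWindow.AllSidesCouplingChessboard`, K1 of the large-field
sparsity line; seat ym-dw-p1 g3).  Part 2 of 2; part 1 is `…AllSidesChessboardTwistedOddCore`.

For a non-negative functional `ψ` on families `A = (A_o)_{o ∈ O}` of sets of blocks of the odd torus `(ℤ/N)^d`,
invariant under the diagonal unit translations, obeying the TWISTED reflection Cauchy–Schwarz inequalities of every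
axis (components with `cls i o` symmetrised in the closed negative half `symM i 1`, the others in the closed positive
half `csymP i`, and the other way round), with `ψ ⊤ > 0` and `ψ (cylinder over T) ≤ ψ ⊤ ^ #T` for every set `T` of
components, one has `ψ A ^ (N^d) ≤ ψ ⊤ ^ (∑_o #(A o))` (`twisted_chessboard_pow_le_odd`) and
`ψ A ≤ ψ ⊤ ^ ((∑_o #(A o)) / N^d)` (`twisted_chessboard_le_rpow_odd`).

Proof: a maximiser of `Φ` stays a maximiser under both twisted symmetrisations and under translations (part 1); along
one axis the run-doubling walk `OddChessboard.walk` is run TWICE on the assignment of slices — first with the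
`twP`-move (`plusHalf` on the un-twisted slices, `minusHalf` on the twisted ones) until the un-twisted components are
constant, then with the `twM`-move (which keeps constant components constant) until the twisted components are
constant; the result is a maximiser all of whose components are cylinders along that axis, and cylinders along the
earlier axes stay cylinders.  After `d` axes every component is `∅` or `univ`, where `Φ ≤ 1` by the cylinder
hypothesis.  This is the combinatorial core of the Fröhlich–Lieb transfer-matrix chessboard for alternating products
`Tr ∏ M_s K_s`, in reflection-positivity language; no measure theory here.

References: J. Fröhlich, E. H. Lieb, Comm. Math. Phys. 60 (1978) 233–267, Thm. 2.2/2.3; J. Fröhlich, R. Israel,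
E. H. Lieb, B. Simon, Comm. Math. Phys. 62 (1978) 1–34, Thm. 2.2 (maximisation proof) and Thm. 4.1.  Nothing here is
a statement about the Yang–Mills mass gap.
-/

noncomputable section

open Finset
open Literature.Barriers.CriticalPhenomena.NonGibbs
open Literature.Probability.LatticeModels
open Literature.Probability.LatticeModels.OddChessboard

namespace Summit.QuantumFields.YangMills.Theorems.AllSidesChessboard

/-! ### §5. Growing a maximiser along one axis: the two-phase walk -/

section Walk

variable {d S : ℕ} {O : Type*} [Fintype O] (cls : Fin d → O → Bool)
  (ψ : (O → Finset (BlockIdx d (2 * S + 1))) → ℝ)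

omit [Fintype O] in
/-- Restricting `plusHalf` of a family-valued assignment to one component. -/
theorem plusHalf_apply_comp (σ : ZMod (2 * S + 1) → O → Finset (BlockIdx d (2 * S + 1))) (o : O) :
    (fun t => plusHalf σ t o) = plusHalf (fun t => σ t o) := by
  funext t
  unfold plusHalf
  split_ifs <;> rfl

/-- `plusHalf` of a constant assignment is the constant assignment. -/
theorem plusHalf_const {ι : Type*} (k : ι) : plusHalf (S := S) (fun _ => k) = fun _ => k := by
  funext t
  unfold plusHalf
  split_ifs <;> rfl

/-- `minusHalf` of a constant assignment is the constant assignment. -/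
theorem minusHalf_const {ι : Type*} (k : ι) : minusHalf (S := S) (fun _ => k) = fun _ => k := by
  funext t
  unfold minusHalf
  split_ifs <;> rfl

omit [Fintype O] in
/-- **Gluing the twisted plus-move** (`plusHalf` on the transverse components, `minusHalf` on the in-plane ones)
**is the twisted positive symmetrisation of the glued family.** -/
theorem glue_twPlus (hS : 1 ≤ S) (i : Fin d) (σ : ZMod (2 * S + 1) → O → Finset (BlockIdx d (2 * S + 1))) :
    (fun o => glueSlices i (fun t =>
        if cls i o then minusHalf (fun t => σ t o) t else plusHalf (fun t => σ t o) t)) =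
      fun o => if cls i o then symM i 1 (glueSlices i fun t => σ t o) else csymP i (glueSlices i fun t => σ t o) := by
  funext o
  cases cls i o
  · simp only [Bool.false_eq_true, ↓reduceIte]
    exact glue_plusHalf hS i _
  · simp only [↓reduceIte]
    exact glue_minusHalf hS i _

omit [Fintype O] in
/-- **Gluing the twisted minus-move is the twisted negative symmetrisation of the glued family.** -/
theorem glue_twMinus (hS : 1 ≤ S) (i : Fin d) (σ : ZMod (2 * S + 1) → O → Finset (BlockIdx d (2 * S + 1))) :
    (fun o => glueSlices i (fun t =>
        if cls i o then plusHalf (fun t => σ t o) t else minusHalf (fun t => σ t o) t)) =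
      fun o => if cls i o then csymP i (glueSlices i fun t => σ t o) else symM i 1 (glueSlices i fun t => σ t o) := by
  funext o
  cases cls i o
  · simp only [Bool.false_eq_true, ↓reduceIte]
    exact glue_minusHalf hS i _
  · simp only [↓reduceIte]
    exact glue_plusHalf hS i _

omit [Fintype O] in
/-- Gluing a rotated family-valued assignment is translating every glued component. -/
theorem glue_rotate_family (i : Fin d) (σ : ZMod (2 * S + 1) → O → Finset (BlockIdx d (2 * S + 1)))
    (a : ZMod (2 * S + 1)) :
    (fun o => glueSlices i (fun t => σ (t + a) o)) =
      fun o => (glueSlices i fun t => σ t o).image (cellTranslate i (-a)) := by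
  funext o
  exact glueSlices_rotate i (fun t => σ t o) a

omit [Fintype O] in
/-- **Growing a maximiser along the axis `i` (two-phase run-doubling walk).**  If `P` is a property of families that
is stable under both twisted symmetrisations of the axis `i` and under the translations of the axis `i`, then from any
family with `P` one reaches a family with `P` all of whose components are cylinders along `i`. -/
theorem exists_cyl_of_stable (hS : 1 ≤ S) {P : (O → Finset (BlockIdx d (2 * S + 1))) → Prop}
    (i : Fin d)
    (hP : ∀ A, P A → P (fun o => if cls i o then symM i 1 (A o) else csymP i (A o)))
    (hM : ∀ A, P A → P (fun o => if cls i o then csymP i (A o) else symM i 1 (A o)))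
    (hT : ∀ A (a : ZMod (2 * S + 1)), P A → P (fun o => (A o).image (cellTranslate i a)))
    {A : O → Finset (BlockIdx d (2 * S + 1))} (hA : P A) :
    ∃ A' : O → Finset (BlockIdx d (2 * S + 1)), P A' ∧
      ∀ o, ∀ c ∈ A' o, ∀ t : ZMod (2 * S + 1), Function.update c i t ∈ A' o := by
  classical
  -- `Q σ`: the glued family of the assignment `σ` has `P`
  let glue : (ZMod (2 * S + 1) → O → Finset (BlockIdx d (2 * S + 1))) → O → Finset (BlockIdx d (2 * S + 1)) :=
    fun σ o => glueSlices i fun t => σ t o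
  have hglueP : ∀ σ, P (glue σ) → P (glue fun t o =>
      if cls i o then minusHalf (fun t => σ t o) t else plusHalf (fun t => σ t o) t) := by
    intro σ hσ
    have h := glue_twPlus cls hS i σ
    change glue _ = _ at h
    rw [h]; exact hP _ hσ
  have hglueM : ∀ σ, P (glue σ) → P (glue fun t o =>
      if cls i o then plusHalf (fun t => σ t o) t else minusHalf (fun t => σ t o) t) := by
    intro σ hσ
    have h := glue_twMinus cls hS i σ
    change glue _ = _ at h
    rw [h]; exact hM _ hσ
  have hglueR : ∀ σ (a : ZMod (2 * S + 1)), P (glue σ) → P (glue fun t => σ (t + a)) := by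
    intro σ a hσ
    have h := glue_rotate_family i σ a
    change glue _ = _ at h
    rw [h]; exact hT _ _ hσ
  -- the assignment of slices of `A`
  let σ₀ : ZMod (2 * S + 1) → O → Finset (BlockIdx d (2 * S + 1)) := fun t o => (A o).filter fun c => c i = t
  have hσ₀ : glue σ₀ = A := by
    funext o; exact glueSlices_slices i (A o)
  -- PHASE 1: make the transverse components constant
  have phase1 : ∃ σ₁ : ZMod (2 * S + 1) → O → Finset (BlockIdx d (2 * S + 1)), P (glue σ₁) ∧
      ∀ o, cls i o = false → ∀ t, σ₁ t o = σ₀ 0 o := by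
    have key := walk hS
      (P := fun τ : ZMod (2 * S + 1) → O → Finset (BlockIdx d (2 * S + 1)) =>
        ∃ σ, P (glue σ) ∧ ∀ o, cls i o = false → ∀ t, σ t o = τ t o)
      (fun τ ⟨σ, hσ, hστ⟩ => ⟨_, hglueP σ hσ, fun o ho t => by
        simp only [ho, Bool.false_eq_true, ↓reduceIte, plusHalf]
        split_ifs <;> exact hστ o ho _⟩)
      (fun τ a ⟨σ, hσ, hστ⟩ => ⟨_, hglueR σ a hσ, fun o ho t => hστ o ho _⟩)
      (σ := σ₀) ⟨σ₀, by rw [hσ₀]; exact hA, fun _ _ _ => rfl⟩ 0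
    obtain ⟨σ₁, hσ₁, h⟩ := key
    exact ⟨σ₁, hσ₁, h⟩
  obtain ⟨σ₁, hσ₁P, hσ₁c⟩ := phase1
  -- PHASE 2: make the in-plane components constant, keeping the transverse ones constant
  have phase2 : ∃ σ₂ : ZMod (2 * S + 1) → O → Finset (BlockIdx d (2 * S + 1)), P (glue σ₂) ∧
      (∀ o, cls i o = false → ∀ t, σ₂ t o = σ₀ 0 o) ∧ ∀ o, cls i o = true → ∀ t, σ₂ t o = σ₁ 0 o := by
    have key := walk hS
      (P := fun τ : ZMod (2 * S + 1) → O → Finset (BlockIdx d (2 * S + 1)) =>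
        ∃ σ, P (glue σ) ∧ (∀ o, cls i o = false → ∀ t, σ t o = σ₀ 0 o) ∧
          ∀ o, cls i o = true → ∀ t, σ t o = τ t o)
      (fun τ ⟨σ, hσ, hσc, hστ⟩ => ⟨_, hglueM σ hσ, fun o ho t => by
          simp only [ho, Bool.false_eq_true, ↓reduceIte]
          have hconst : (fun t => σ t o) = fun _ => σ₀ 0 o := funext (hσc o ho)
          rw [hconst, minusHalf_const],
        fun o ho t => by
          simp only [ho, ↓reduceIte, plusHalf]
          split_ifs <;> exact hστ o ho _⟩)
      (fun τ a ⟨σ, hσ, hσc, hστ⟩ => ⟨_, hglueR σ a hσ, fun o ho t => hσc o ho _, fun o ho t => hστ o ho _⟩)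
      (σ := σ₁) ⟨σ₁, hσ₁P, hσ₁c, fun _ _ _ => rfl⟩ 0
    obtain ⟨σ₂, hσ₂, h1, h2⟩ := key
    exact ⟨σ₂, hσ₂, h1, h2⟩
  obtain ⟨σ₂, hσ₂P, hσ₂c, hσ₂c'⟩ := phase2
  refine ⟨glue σ₂, hσ₂P, fun o => ?_⟩
  -- every component of `glue σ₂` is glued from a constant assignment
  have hconst : (fun t => σ₂ t o) = fun _ => σ₂ 0 o := by
    funext t
    cases h : cls i o
    · rw [hσ₂c o h t, hσ₂c o h 0]
    · rw [hσ₂c' o h t, hσ₂c' o h 0]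
  change ∀ c ∈ glueSlices i (fun t => σ₂ t o), ∀ t, Function.update c i t ∈ glueSlices i (fun t => σ₂ t o)
  rw [hconst]
  exact cyl_glueSlices_const i _

end Walk

/-! ### §6. The twisted chessboard estimate for odd sides -/

section Main

variable {d S : ℕ} {O : Type*} [Fintype O] [DecidableEq O] (cls : Fin d → O → Bool)

/-- **The twisted two-class chessboard estimate, power form, on the block torus of odd side `2S+1`, `S ≥ 1`.** -/
theorem twisted_chessboard_pow_le_odd' (hS : 1 ≤ S) {ψ : (O → Finset (BlockIdx d (2 * S + 1))) → ℝ}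
    (h0 : ∀ A, 0 ≤ ψ A) (h1 : 0 < ψ fun _ => univ)
    (htr : ∀ (i : Fin d) (a : ZMod (2 * S + 1)) (A : O → Finset (BlockIdx d (2 * S + 1))),
      ψ (fun o => (A o).image (cellTranslate i a)) = ψ A)
    (hcs : ∀ (i : Fin d) (A : O → Finset (BlockIdx d (2 * S + 1))),
      ψ A ^ 2 ≤ ψ (fun o => if cls i o then symM i 1 (A o) else csymP i (A o)) *
        ψ (fun o => if cls i o then csymP i (A o) else symM i 1 (A o)))
    (hcyl : ∀ T : Finset O, ψ (fun o => if o ∈ T then univ else ∅) ≤ (ψ fun _ => univ) ^ #T)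
    (A : O → Finset (BlockIdx d (2 * S + 1))) :
    ψ A ^ ((2 * S + 1) ^ d) ≤ (ψ fun _ => univ) ^ (∑ o, #(A o)) := by
  classical
  obtain ⟨Amax, -, hAmax⟩ := Finset.exists_max_image (univ : Finset (O → Finset (BlockIdx d (2 * S + 1))))
    (tPhi ψ) ⟨A, mem_univ _⟩
  set M := tPhi ψ Amax with hM
  have hmax : ∀ B, tPhi ψ B ≤ M := fun B => hAmax B (mem_univ B)
  have hden : 0 < (ψ fun _ => univ) ^ (∑ o, #(A o)) := pow_pos h1 _
  -- if `M ≤ 0` there is nothing to prove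
  by_cases hMpos : M ≤ 0
  · have h := (hmax A).trans hMpos
    rw [tPhi, div_le_iff₀ hden, zero_mul] at h
    exact h.trans (pow_nonneg h1.le _)
  rw [not_le] at hMpos
  -- otherwise produce a maximiser all of whose components are cylinders along every axis
  have grow : ∀ m : ℕ, m ≤ d → ∃ A' : O → Finset (BlockIdx d (2 * S + 1)), tPhi ψ A' = M ∧
      ∀ j : Fin d, j.val < m → ∀ o, ∀ c ∈ A' o, ∀ t : ZMod (2 * S + 1), Function.update c j t ∈ A' o := by
    intro m
    induction m with
    | zero => exact fun _ => ⟨Amax, rfl, fun j hj => absurd hj (Nat.not_lt_zero _)⟩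
    | succ m ih =>
      intro hm
      obtain ⟨A₁, hA₁, hcyl₁⟩ := ih (Nat.le_of_succ_le hm)
      have hi : m < d := hm
      obtain ⟨A₂, ⟨hA₂, hcyl₂⟩, hcyl₂'⟩ := exists_cyl_of_stable cls hS
        (P := fun B => tPhi ψ B = M ∧
          ∀ j : Fin d, j.val < m → ∀ o, ∀ c ∈ B o, ∀ t : ZMod (2 * S + 1), Function.update c j t ∈ B o)
        ⟨m, hi⟩
        (fun B ⟨hB, hBc⟩ => ⟨(tPhi_tw_eq_of_isMax cls ψ hS h0 h1 hcs hMpos hmax hB ⟨m, hi⟩).1,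
          fun j hj o => by
            have hji : j ≠ ⟨m, hi⟩ := fun h => by rw [h] at hj; exact lt_irrefl _ hj
            dsimp only
            split_ifs
            · exact cyl_symM hji 1 (hBc j hj o)
            · exact cyl_csymP hji (hBc j hj o)⟩)
        (fun B ⟨hB, hBc⟩ => ⟨(tPhi_tw_eq_of_isMax cls ψ hS h0 h1 hcs hMpos hmax hB ⟨m, hi⟩).2,
          fun j hj o => by
            have hji : j ≠ ⟨m, hi⟩ := fun h => by rw [h] at hj; exact lt_irrefl _ hj
            dsimp only
            split_ifs
            · exact cyl_csymP hji (hBc j hj o)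
            · exact cyl_symM hji 1 (hBc j hj o)⟩)
        (fun B a ⟨hB, hBc⟩ => ⟨by rw [tPhi_translate ψ htr]; exact hB,
          fun j hj o => by
            have hji : j ≠ ⟨m, hi⟩ := fun h => by rw [h] at hj; exact lt_irrefl _ hj
            exact cyl_translate hji a (hBc j hj o)⟩)
        (A := A₁) ⟨hA₁, hcyl₁⟩
      refine ⟨A₂, hA₂, fun j hj o => ?_⟩
      by_cases hjm : j.val < m
      · exact hcyl₂ j hjm o
      · have : j = ⟨m, hi⟩ := Fin.ext (by simp only; omega)
        subst this
        exact hcyl₂' o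
  obtain ⟨A', hA', hcylA⟩ := grow d le_rfl
  -- every component of `A'` is `∅` or `univ`
  have hdich : ∀ o, A' o = ∅ ∨ A' o = univ := by
    intro o
    by_cases he : A' o = ∅
    · exact Or.inl he
    · obtain ⟨c₀, hc₀⟩ := Finset.nonempty_iff_ne_empty.2 he
      exact Or.inr (eq_univ_of_forall_cyl (fun j => hcylA j j.isLt o) hc₀)
  obtain ⟨T, hT⟩ : ∃ T : Finset O, A' = fun o => if o ∈ T then univ else ∅ := by
    refine ⟨univ.filter fun o => A' o = univ, funext fun o => ?_⟩
    by_cases ho : A' o = univ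
    · rw [if_pos (show o ∈ univ.filter (fun o => A' o = univ) from mem_filter.2 ⟨mem_univ o, ho⟩), ho]
    · rw [if_neg (show o ∉ univ.filter (fun o => A' o = univ) from fun h => ho (mem_filter.1 h).2)]
      exact (hdich o).resolve_right ho
  subst hT
  -- hence `M = Φ A' ≤ 1`
  have hcardU : #(univ : Finset (BlockIdx d (2 * S + 1))) = (2 * S + 1) ^ d := by
    rw [card_univ, Fintype.card_fun, ZMod.card, Fintype.card_fin]
  have hsize : ∑ o, #((fun o => if o ∈ T then (univ : Finset (BlockIdx d (2 * S + 1))) else ∅) o) =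
      #T * (2 * S + 1) ^ d := by
    simp_rw [apply_ite Finset.card, hcardU, card_empty]
    rw [Finset.sum_ite_mem, univ_inter, sum_const, smul_eq_mul]
  have hMle : M ≤ 1 := by
    rw [← hA', tPhi, hsize, div_le_one (pow_pos h1 _), pow_mul]
    exact pow_le_pow_left₀ (h0 _) (hcyl T) _
  have h := (hmax A).trans hMle
  rw [tPhi, div_le_one hden] at h
  exact h

variable {N : ℕ} [NeZero N]

/-- **The twisted two-class chessboard estimate, power form, for every ODD side `N ≥ 3`.**  A functional `ψ ≥ 0` on
families `A = (A_o)_{o ∈ O}` of sets of blocks of `(ℤ/N)^d`, with `ψ ⊤ > 0`, invariant under the diagonal unit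
translations, bounded on cylinders by `ψ (cyl T) ≤ ψ ⊤ ^ #T`, and obeying for every axis `i` the TWISTED reflection
Cauchy–Schwarz inequality (components with `cls i o` symmetrised in the closed negative half `symM i 1`, the others in
the closed positive half `csymP i`, and the other way round), satisfies `ψ A ^ (N^d) ≤ ψ ⊤ ^ (∑_o #(A o))`. -/
theorem twisted_chessboard_pow_le_odd (hN : Odd N) (h3 : 3 ≤ N) {ψ : (O → Finset (BlockIdx d N)) → ℝ}
    (h0 : ∀ A, 0 ≤ ψ A) (h1 : 0 < ψ fun _ => univ)
    (htr : ∀ (i : Fin d) (a : ZMod N) (A : O → Finset (BlockIdx d N)),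
      ψ (fun o => (A o).image (cellTranslate i a)) = ψ A)
    (hcs : ∀ (i : Fin d) (A : O → Finset (BlockIdx d N)),
      ψ A ^ 2 ≤ ψ (fun o => if cls i o then symM i 1 (A o) else csymP i (A o)) *
        ψ (fun o => if cls i o then csymP i (A o) else symM i 1 (A o)))
    (hcyl : ∀ T : Finset O, ψ (fun o => if o ∈ T then univ else ∅) ≤ (ψ fun _ => univ) ^ #T)
    (A : O → Finset (BlockIdx d N)) :
    ψ A ^ (N ^ d) ≤ (ψ fun _ => univ) ^ (∑ o, #(A o)) := by
  obtain ⟨S, rfl⟩ := hN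
  exact twisted_chessboard_pow_le_odd' cls (by omega) h0 h1 htr hcs hcyl A

/-- **The twisted two-class chessboard estimate for every odd side `N ≥ 3`**, usual form
`ψ A ≤ ψ ⊤ ^ ((∑_o #(A o)) / N^d)`. -/
theorem twisted_chessboard_le_rpow_odd (hN : Odd N) (h3 : 3 ≤ N) {ψ : (O → Finset (BlockIdx d N)) → ℝ}
    (h0 : ∀ A, 0 ≤ ψ A) (h1 : 0 < ψ fun _ => univ)
    (htr : ∀ (i : Fin d) (a : ZMod N) (A : O → Finset (BlockIdx d N)),
      ψ (fun o => (A o).image (cellTranslate i a)) = ψ A)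
    (hcs : ∀ (i : Fin d) (A : O → Finset (BlockIdx d N)),
      ψ A ^ 2 ≤ ψ (fun o => if cls i o then symM i 1 (A o) else csymP i (A o)) *
        ψ (fun o => if cls i o then csymP i (A o) else symM i 1 (A o)))
    (hcyl : ∀ T : Finset O, ψ (fun o => if o ∈ T then univ else ∅) ≤ (ψ fun _ => univ) ^ #T)
    (A : O → Finset (BlockIdx d N)) :
    ψ A ≤ (ψ fun _ => univ) ^ (((∑ o, #(A o) : ℕ) : ℝ) / (N : ℝ) ^ d) := by
  have hNd : (0 : ℝ) < (N : ℝ) ^ d := by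
    have : (0 : ℝ) < N := by exact_mod_cast Nat.pos_of_ne_zero (NeZero.ne N)
    positivity
  have h := twisted_chessboard_pow_le_odd cls hN h3 h0 h1 htr hcs hcyl A
  have hroot : ψ A = (ψ A ^ (N ^ d)) ^ ((1 : ℝ) / (N : ℝ) ^ d) := by
    rw [← Real.rpow_natCast, ← Real.rpow_mul (h0 A)]
    push_cast
    rw [mul_one_div_cancel hNd.ne', Real.rpow_one]
  rw [hroot]
  calc (ψ A ^ N ^ d) ^ ((1 : ℝ) / (N : ℝ) ^ d)
      ≤ ((ψ fun _ => univ) ^ (∑ o, #(A o))) ^ ((1 : ℝ) / (N : ℝ) ^ d) :=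
        Real.rpow_le_rpow (pow_nonneg (h0 A) _) h (by positivity)
    _ = (ψ fun _ => univ) ^ (((∑ o, #(A o) : ℕ) : ℝ) / (N : ℝ) ^ d) := by
        rw [← Real.rpow_natCast, ← Real.rpow_mul h1.le]
        congr 1
        ring

end Main

end Summit.QuantumFields.YangMills.Theorems.AllSidesChessboard

end

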